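import Literature.NumberTheory.Automorphic.ShimuraCurveHeckeMultiplicativityProofs
import Literature.NumberTheory.Automorphic.ShimuraCurveHeckeSelfAdjointProofs
import HarnessLib

/-!
# `S₂^D(M)` has a Petersson-orthonormal basis of simultaneous Hecke eigenforms with real
# eigenvalues (`D > 1`; Pasten 2024, §4.9)

A proofs-only companion (theorems only: no definition, no named fact, nothing restated; D-0026) of
`ShimuraCurve.lean` / `ShimuraCurveRibetTakahashi.lean`, written by the seat of the named fact
`Literature.NumberTheory.Automorphic.nonempty_shimuraParametrizationData` (Jacquet–Langlands
parametrisations by `X₀^D(M)`, Pasten 2024 §2 p. 12), continuing the infrastructure below the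
Jacquet–Langlands transfer (T) to which that fact is reduced for `D > 1`
(`ShimuraParametrizationIsogenyProofs`). Pasten §4.9 p. 15: "the action of `T_{D,M}` on `V_{D,M}`
is simultaneously diagonalizable … systems of Hecke eigenvalues `χ : T_{D,M} → ℂ` … each `χ` takes
values in the ring of integers of a totally real number field … the isotypical subspaces `V^χ` are
orthogonal to each other for the Petersson product". For the generators `T_{D,M,n}` with `n` in a
set of pairwise coprime indices (all primes, in particular) this is assembled here from two bricks
of the tree: the `T_n` are self-adjoint for the Petersson product on the finite-dimensional space
`S₂^D(M)` (`ShimuraCurveData.setIntegral_petersson_linearMap_comm`,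
`ShimuraCurveHeckeSelfAdjointProofs`; Shimura 1971 (3.4.5)) and commute
(`ShimuraCurveData.commute_linearMap_of_coprime`, `ShimuraCurveHeckeMultiplicativityProofs`;
Eichler's unique factorisation), so `S₂^D(M)` is the orthogonal direct sum of the joint eigenspaces
(Mathlib `LinearMap.IsSymmetric.directSum_isInternal_of_pairwise_commute`) and an orthonormal basis
subordinate to it consists of common eigenforms, whose eigenvalues are real
(`LinearMap.IsSymmetric.conj_eigenvalue_eq_self`).

## Contents

* `ShimuraCurveData.exists_basis_simultaneous_heckeFun_eigenforms` — for `S ⊆ ℕ` pairwise coprime: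
  a basis `b₁, …, b_m` of `CuspForm X.Gamma 2` and real `λ_{n,i}` with `T_n bᵢ = λ_{n,i} bᵢ`
  (`n ∈ S`) and `∫_{X.fd} P(bᵢ, bⱼ) = δᵢⱼ`.
* `ShimuraCurveData.exists_basis_simultaneous_heckeFun_eigenforms_primes` — the case of all primes.
* `ShimuraCurveData.exists_simultaneous_heckeFun_eigenform` — if `S₂^D(M) ≠ 0`, a non-zero common eigenform of all
  `T_p`, `p` prime, with real eigenvalues.

## References

* H. Pasten, *Shimura curves and the abc conjecture*, J. Number Theory 254 (2024), §4.9 p. 15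
  [PastenShimura2024].
* G. Shimura, *Introduction to the arithmetic theory of automorphic functions* (1971), §3.4
  Thm. 3.41 and (3.4.5) [ShimuraIATAF1971].
-/

noncomputable section

open UpperHalfPlane MeasureTheory
open scoped MatrixGroups ModularForm Manifold ComplexConjugate

namespace Literature.NumberTheory.Automorphic

namespace ShimuraCurveData

variable {D M : ℕ} (X : ShimuraCurveData D M)

/-! ### A Petersson-orthonormal basis of simultaneous eigenforms (Pasten §4.9) -/

/-- **`S₂^D(M)` has a Petersson-orthonormal basis of simultaneous eigenforms of the `T_{D,M,n}`,
`n` in any set of pairwise coprime indices, with real eigenvalues** (`D > 1`). For `S ⊆ ℕ`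
pairwise coprime (e.g. the set of all primes, `exists_basis_simultaneous_heckeFun_eigenforms_primes`)
there are a basis `b₁, …, b_m` of `S₂(X.Gamma)` (`m = dim S₂^D(M)`) and real numbers `λ_{n,i}`
with `T_n bᵢ = λ_{n,i} bᵢ` for all `n ∈ S` and `∫_{X.fd} P(bᵢ, bⱼ) = δᵢⱼ`. This is Pasten §4.9
p. 15 — "the action of `T_{D,M}` on `V_{D,M}` is simultaneously diagonalizable … each `χ` takes
values in … a totally real number field … the isotypical subspaces are orthogonal to each other for
the Petersson product" — for the generators `T_{D,M,n}`, `n ∈ S`: the `T_n` are self-adjoint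
(`setIntegral_petersson_linearMap_comm`, Shimura 1971 (3.4.5)) and commute
(`commute_linearMap_of_coprime`), so the finite-dimensional Petersson inner product space
`S₂^D(M)` is the orthogonal direct sum of the joint eigenspaces (Mathlib
`LinearMap.IsSymmetric.directSum_isInternal_of_pairwise_commute`). [cite: PastenShimura2024, §4.9 p. 15 (systems of Hecke eigenvalues)] [cite: ShimuraIATAF1971, §3.4 Thm. 3.41 and (3.4.5), PDF pp. 96–99] -/
theorem exists_basis_simultaneous_heckeFun_eigenforms (hD : 1 < D) (hM : 0 < M) (S : Set ℕ)
    (hS : S.Pairwise Nat.Coprime) :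
    ∃ (m : ℕ) (b : Module.Basis (Fin m) ℂ (CuspForm X.Gamma 2)) (ev : S → Fin m → ℝ),
      (∀ (n : S) (i : Fin m), X.heckeFun n (b i) = fun τ => (ev n i : ℂ) * b i τ) ∧
      ∀ i j, ∫ τ in X.fd, petersson 2 (b i) (b j) τ = if i = j then 1 else 0 := by
  classical
  have hF := X.isHypFundamentalDomain_fd
  haveI : FiniteDimensional ℂ (CuspForm X.Gamma 2) := X.finiteDimensional_cuspForm hD 2
  -- the Petersson inner product space structure on `S₂^D(M)`
  let core : InnerProductSpace.Core ℂ (CuspForm X.Gamma 2) :=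
    { inner := fun f g => ∫ τ in X.fd, petersson 2 f g τ
      conj_inner_symm := fun f g => (setIntegral_petersson_symm X.fd g f).symm
      re_inner_nonneg := fun f => by
        show 0 ≤ RCLike.re (∫ τ in X.fd, petersson 2 (⇑f) (⇑f) τ)
        rw [setIntegral_petersson_self, RCLike.re_to_complex, Complex.ofReal_re]
        exact peterssonNormSq_nonneg _ _
      add_left := fun f g h => X.setIntegral_petersson_add_left hD hF f g h
      smul_left := fun f g c => X.setIntegral_petersson_smul_left X.fd c f g
      definite := fun f hf => by
        by_contra hne
        have hne' : (⇑f : ℍ → ℂ) ≠ 0 := fun h => hne (DFunLike.coe_injective (by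
          rw [h]; rfl))
        exact X.setIntegral_petersson_self_ne_zero hD hF f hne' hf }
  letI : NormedAddCommGroup (CuspForm X.Gamma 2) :=
    @InnerProductSpace.Core.toNormedAddCommGroup ℂ _ _ _ _ core
  letI : InnerProductSpace ℂ (CuspForm X.Gamma 2) := InnerProductSpace.ofCore _
  -- the commuting family of symmetric operators `T_n`, `n ∈ S`
  choose T hT using fun n : S => X.exists_linearMap_coe_eq_heckeFun hD (n : ℕ)
  have hsymm : ∀ n : S, (T n).IsSymmetric := fun n f g =>
    X.setIntegral_petersson_linearMap_comm hD hF (hT n) f g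
  have hcomm : Pairwise (Function.onFun Commute T) := fun n n' hne =>
    X.commute_linearMap_of_coprime hD hM (hS n.2 n'.2 fun h => hne (Subtype.ext h)) (hT n) (hT n')
  -- joint eigenspaces
  set V : (S → ℂ) → Submodule ℂ (CuspForm X.Gamma 2) :=
    fun χ => ⨅ n : S, Module.End.eigenspace (T n) (χ n) with hV
  have hint : DirectSum.IsInternal V :=
    LinearMap.IsSymmetric.directSum_isInternal_of_pairwise_commute hsymm hcomm
  have horth : OrthogonalFamily ℂ (fun χ => V χ) fun χ => (V χ).subtypeₗᵢ :=
    LinearMap.IsSymmetric.orthogonalFamily_iInf_eigenspaces hsymm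
  -- finitely many of them are non-zero
  letI : Fintype {χ // V χ ≠ ⊥} := hint.submodule_iSupIndep.fintypeNeBotOfFiniteDimensional
  have hint' : DirectSum.IsInternal (fun χ : {χ // V χ ≠ ⊥} => V χ) :=
    DirectSum.isInternal_ne_bot_iff.mpr hint
  have horth' : OrthogonalFamily ℂ (fun χ : {χ // V χ ≠ ⊥} => V χ)
      fun χ : {χ // V χ ≠ ⊥} => (V χ).subtypeₗᵢ :=
    horth.comp Subtype.val_injective
  set m := Module.finrank ℂ (CuspForm X.Gamma 2)
  have hm : Module.finrank ℂ (CuspForm X.Gamma 2) = m := rfl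
  let B : OrthonormalBasis (Fin m) ℂ (CuspForm X.Gamma 2) := hint'.subordinateOrthonormalBasis hm horth'
  let idx : Fin m → {χ // V χ ≠ ⊥} := fun i => hint'.subordinateOrthonormalBasisIndex hm i horth'
  have hBmem : ∀ i, B i ∈ V (idx i).val := fun i =>
    hint'.subordinateOrthonormalBasis_subordinate hm i horth'
  refine ⟨m, B.toBasis, fun n i => ((idx i).val n).re, fun n i => ?_, fun i j => ?_⟩
  · set χ : S → ℂ := (idx i).val with hχ
    have hmem : B i ∈ Module.End.eigenspace (T n) (χ n) := (Submodule.mem_iInf _).mp (hBmem i) n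
    have hTi : T n (B i) = χ n • B i := Module.End.mem_eigenspace_iff.mp hmem
    have hne : B i ≠ 0 := B.orthonormal.ne_zero i
    have hreal : conj (χ n) = χ n := (hsymm n).conj_eigenvalue_eq_self
      (Module.End.hasEigenvalue_of_hasEigenvector (Module.End.hasEigenvector_iff.mpr ⟨hmem, hne⟩))
    have hχre : ((χ n).re : ℂ) = χ n := Complex.conj_eq_iff_re.mp hreal
    rw [OrthonormalBasis.coe_toBasis, ← hT n, hTi, CuspForm.IsGLPos.coe_smul, hχre]
    funext τ
    simp only [Pi.smul_apply, smul_eq_mul]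
  · have h := B.orthonormal
    rw [OrthonormalBasis.coe_toBasis]
    exact orthonormal_iff_ite.mp h i j

/-- **Simultaneous eigenbasis for all `T_p`, `p` prime** (`D > 1`): a Petersson-orthonormal basis of
`S₂^D(M)` of common eigenforms of the `T_{D,M,p}` over all primes `p`, with real eigenvalues
`λ_p(bᵢ)` — the systems of Hecke eigenvalues `χᵢ = (λ_p(bᵢ))_p` of Pasten §4.9 on the prime-index
generators (distinct primes are coprime). [cite: PastenShimura2024, §4.9 p. 15 (systems of Hecke eigenvalues)] -/
theorem exists_basis_simultaneous_heckeFun_eigenforms_primes (hD : 1 < D) (hM : 0 < M) :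
    ∃ (m : ℕ) (b : Module.Basis (Fin m) ℂ (CuspForm X.Gamma 2)) (ev : ℕ → Fin m → ℝ),
      (∀ p : ℕ, p.Prime → ∀ i : Fin m, X.heckeFun p (b i) = fun τ => (ev p i : ℂ) * b i τ) ∧
      ∀ i j, ∫ τ in X.fd, petersson 2 (b i) (b j) τ = if i = j then 1 else 0 := by
  classical
  have hS : {p : ℕ | p.Prime}.Pairwise Nat.Coprime := fun p hp q hq hpq =>
    (Nat.coprime_primes hp hq).mpr hpq
  obtain ⟨m, b, ev, hev, horth⟩ := X.exists_basis_simultaneous_heckeFun_eigenforms hD hM _ hS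
  refine ⟨m, b, fun p i => if hp : p.Prime then ev ⟨p, hp⟩ i else 0, fun p hp i => ?_, horth⟩
  simp only [hp, dif_pos]
  exact hev ⟨p, hp⟩ i

/-- **Existence of a simultaneous Hecke eigenform on `X₀^D(M)`** (`D > 1`): if `S₂^D(M) ≠ 0` there is
a non-zero cusp form `g ∈ S₂(X.Gamma)` with `T_p g = λ_p g` for every prime `p`, all `λ_p` real —
a vector of the simultaneous eigenbasis. (The Jacquet–Langlands transfer (T), to which the tree
reduces `nonempty_shimuraParametrizationData` for `D > 1`, asserts much more: which systems
`(λ_p)_p` occur, namely those of the newforms of level `D M`.) [cite: PastenShimura2024, §4.9 p. 15 (systems of Hecke eigenvalues)] -/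
theorem exists_simultaneous_heckeFun_eigenform (hD : 1 < D) (hM : 0 < M)
    [Nontrivial (CuspForm X.Gamma 2)] :
    ∃ (g : CuspForm X.Gamma 2) (ev : ℕ → ℝ), (⇑g : ℍ → ℂ) ≠ 0 ∧
      ∀ p : ℕ, p.Prime → X.heckeFun p g = fun τ => (ev p : ℂ) * g τ := by
  obtain ⟨m, b, ev, hev, -⟩ := X.exists_basis_simultaneous_heckeFun_eigenforms_primes hD hM
  obtain ⟨i⟩ := b.index_nonempty
  refine ⟨b i, fun p => ev p i, fun h0 => b.ne_zero i (DFunLike.coe_injective ?_), fun p hp => hev p hp i⟩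
  rw [h0]
  rfl

end ShimuraCurveData

end Literature.NumberTheory.Automorphic

end
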